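import Summits.PneNP.PneNP.Theorems.NegLimitedAmplifiedWindowSlicesEval
import Literature.Barriers.PneNP.MonotoneGapProofs
import Mathlib
import HarnessLib

/-!
# Route NegLimited — line `amplified-window`, stub `stub_slicesNP` (rung F-N1/p3, ROUND-11)

Registered stub (S) of the skeleton `amplified-window` on the door item
`NegLimited.NeglimitedEpsLogNegationsR` (stmt-PneNP-19860; card HOME/pnp-ideate-p3/r11/amplified-window.md
§4): `AmplifiedCliqueSlicesNP` — ONE language `L ∈ NP` whose slice at every length
`ampLen n k = 3^{⌊log₃ n⌋}·n² + k` (`3 ≤ k < n`) is monotone and inherits every negation-limited De Morgan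
lower bound proved for `RM3_d ⊗ CLIQUE(n,k)` (`ampFn (Nat.log 3 n) (cliqueFn n k)`, `d = ⌊log₃ n⌋`).

The witness is `SlicesNP.ampCliqueLang` (`NegLimitedAmplifiedWindowSlicesVerifier.lean`: verifier
`verdict ∈ FP` on codes, `ampCliqueLang ∈ NP`; `NegLimitedAmplifiedWindowSlicesEval.lean`: the rounds
evaluate `RM3_d`, the length pins the parameters).  Here:
* `sliceFn_ampCliqueLang`: the slice at `ampLen n k` is `ampSlice n k` = `x ↦ RM3_d (w ↦ CLIQUE(n,k)(block
  w of x))` (soundness: marked `k`-sets are cliques and `RM3` is monotone; completeness: mark a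
  `k`-clique in every block that has one);
* the input retraction `ampRetract` (position ↦ (block, edge); padding and off-triangle positions are
  harmless) with `sliceFn (y ∘ ampRetract) = ampFn d (cliqueFn n k) y`, nonemptiness of the admissible
  class (`exists_monotone_circuit`), and the transfer `NegLimSlices.le_negLimitedSizeOver_of_retract`;
* `theorem stub_slicesNP : AmplifiedCliqueSlicesNP`.

References: S. Arora, B. Barak, *Computational Complexity* (2009), §2.1 Ex. 2.2, §6.1 [AroraBarakCC2009];
R. O'Donnell, *Hardness amplification within NP*, JCSS 69 (2004), §1 [ODonnell2004].

HONEST FRAMING: `NP`-membership and slice plumbing for stub S of a line whose load-bearing stub (A,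
monotone hardness amplification) is OPEN; the door item is NOT closed by this file; FRONTIER rung F-N1 —
nothing here bears on P vs NP.
-/

set_option linter.dupNamespace false -- `Summit.PneNP.PneNP.…`: summit = sub-problem name (D-0017 single-conjunct layout)

namespace Summit.PneNP.PneNP.Theorems.NegLimitedAmplifiedWindow

open Finset
open Literature.Computability.Complexity Literature.Barriers.PneNP
open Summit.PneNP.PneNP.Theorems.NegLimSlices
open SlicesNP
variable {n k : ℕ}

/-- **The slice of `ampCliqueLang` at length `ampLen n k`** (`3 ≤ k < n`) is `ampSlice n k`. -/
theorem sliceFn_ampCliqueLang (hk : 3 ≤ k) (hkn : k < n) (x : Fin (ampLen n k) → Bool) :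
    ampCliqueLang.sliceFn (ampLen n k) x = ampSlice n k x := by
  classical
  set d := Nat.log 3 n with hd
  have hn0 : n ≠ 0 := by omega
  have h3d : 3 ^ d ≤ n := Nat.pow_log_le_self 3 hn0
  have h3d' : n < 3 ^ (d + 1) := Nat.lt_pow_succ_log_self (by norm_num) n
  have hu : (List.ofFn x).length = ampLen n k := by simp
  have hmem : ampCliqueLang.boolIndicator (List.ofFn x) = true ↔
      ∃ y : List Bool, y.length ≤ 4 * (List.ofFn x).length + 8 ∧ verdict (List.ofFn x, y) = true := by
    rw [← Set.mem_iff_boolIndicator]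
    exact mem_ampCliqueLang
  rw [Bool.eq_iff_iff]
  change ampCliqueLang.boolIndicator (List.ofFn x) = true ↔ _
  rw [hmem, hu]
  constructor
  · -- soundness
    rintro ⟨y, -, hv⟩
    obtain ⟨hc, hres⟩ := verdict_eq_true_iff.1 hv
    obtain ⟨hn, hk', hdd⟩ := params_of_checks hkn hu hc
    rw [hn, hk', hdd, lev0, min_eq_left h3d, rounds_eval] at hres
    change recMaj3 d (fun w => blockBit (List.ofFn x) (cT y) n k (finFunctionFinEquiv w)) = true at hres
    have hle : recMaj3 d (fun w => blockBit (List.ofFn x) (cT y) n k (finFunctionFinEquiv w)) ≤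
        ampSlice n k x :=
      recMaj3_monotone d fun w => by
        by_cases hb : blockBit (List.ofFn x) (cT y) n k (finFunctionFinEquiv w) = true
        · rw [hb, clique_of_blockBit x (cT y) w hb]
        · rw [Bool.not_eq_true] at hb; rw [hb]; exact Bool.false_le _
    rw [hres] at hle
    exact top_le_iff.1 hle
  · -- completeness: mark a `k`-clique in every block that has one
    intro hx
    -- the chosen cliques
    have hS : ∀ w : Fin d → Fin 3, ∃ S : Finset (Fin n), cliqueFn n k (edgeVec (blockVec x w)) = true →
        S.card = k ∧ ∀ a ∈ S, ∀ b ∈ S, a < b → ∀ h : (b : ℕ) + n * (a : ℕ) < n * n,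
          blockVec x w ⟨(b : ℕ) + n * (a : ℕ), h⟩ = true := by
      intro w
      by_cases h : cliqueFn n k (edgeVec (blockVec x w)) = true
      · obtain ⟨S, hS⟩ := (cliqueFn_edgeVec_iff k (blockVec x w)).1 h
        exact ⟨S, fun _ => hS⟩
      · exact ⟨∅, fun h' => absurd h' h⟩
    choose S hS using hS
    -- the mark predicate and the mark string
    set mark : ℕ → ℕ → Bool := fun w' v => decide (∃ hw : w' < 3 ^ d, ∃ hv : v < n,
      cliqueFn n k (edgeVec (blockVec x (finFunctionFinEquiv.symm ⟨w', hw⟩))) = true ∧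
        (⟨v, hv⟩ : Fin n) ∈ S (finFunctionFinEquiv.symm ⟨w', hw⟩)) with hmark
    set T : List Bool := (List.range (3 ^ d * n)).map fun i => mark (i / n) (i % n) with hT
    have hTget : ∀ {w' v : ℕ}, w' < 3 ^ d → v < n → T.getD (w' * n + v) false = mark w' v := by
      intro w' v hw hv
      have hi : w' * n + v < 3 ^ d * n := by nlinarith
      rw [hT, List.getD_eq_getElem?_getD, List.getElem?_map, List.getElem?_range hi, Option.map_some,
        Option.getD_some]
      have hn' : 0 < n := by omega
      rw [Nat.add_comm, Nat.add_mul_div_right _ _ hn', Nat.div_eq_of_lt hv, zero_add, Nat.add_mul_mod_self_right,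
        Nat.mod_eq_of_lt hv]
    -- the block bits of the honest certificate are the clique indicators
    have hbits : ∀ w : Fin d → Fin 3,
        blockBit (List.ofFn x) T n k (finFunctionFinEquiv w) = cliqueFn n k (edgeVec (blockVec x w)) := by
      intro w
      have hw := (finFunctionFinEquiv w).2
      have hsymm : ∀ h : (finFunctionFinEquiv w : ℕ) < 3 ^ d,
          finFunctionFinEquiv.symm ⟨(finFunctionFinEquiv w : ℕ), h⟩ = w := fun h => by
        rw [Fin.eta]; exact Equiv.symm_apply_apply _ _
      -- marked vertices of block `w`
      have hmarked : ∀ v : Fin n, T.getD ((finFunctionFinEquiv w : ℕ) * n + v) false = true ↔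
          cliqueFn n k (edgeVec (blockVec x w)) = true ∧ v ∈ S w := by
        intro v
        rw [hTget hw v.2]
        simp only [hmark, decide_eq_true_iff]
        constructor
        · intro h
          obtain ⟨hw', hv, h1, h2⟩ := h
          rw [hsymm hw'] at h1 h2
          exact ⟨h1, by simpa using h2⟩
        · intro h
          refine ⟨hw, v.2, ?_, ?_⟩
          · rw [hsymm hw]; exact h.1
          · rw [hsymm hw]; simpa using h.2
      have hcount : markCount T n (finFunctionFinEquiv w) =
          (univ.filter fun v : Fin n => cliqueFn n k (edgeVec (blockVec x w)) = true ∧ v ∈ S w).card := by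
        rw [markCount_eq_card, ← card_filter_univ_fin n fun v =>
          T.getD ((finFunctionFinEquiv w : ℕ) * n + v) false = true]
        congr 1
        ext v
        simp only [mem_filter, mem_univ, true_and, hmarked v]
      by_cases hcl : cliqueFn n k (edgeVec (blockVec x w)) = true
      · obtain ⟨hcard, hpairs⟩ := hS w hcl
        rw [hcl, blockBit_eq_true_iff, hcount]
        refine ⟨?_, fun a b ha hb hab hTa hTb => ?_⟩
        · calc _ = (S w).card := by congr 1; ext v; simp [hcl]
            _ = k := hcard
        · have ha' := (hmarked ⟨a, ha⟩).1 hTa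
          have hb' := (hmarked ⟨b, hb⟩).1 hTb
          have hlt : b + n * a < n * n := by nlinarith
          rw [getD_ofFn_block x w hlt]
          exact hpairs _ ha'.2 _ hb'.2 hab hlt
      · rw [Bool.not_eq_true] at hcl
        rw [hcl, Bool.eq_false_iff, Ne, blockBit_eq_true_iff, hcount, not_and]
        intro hcard
        exfalso
        have : (univ.filter fun v : Fin n => cliqueFn n k (edgeVec (blockVec x w)) = true ∧ v ∈ S w) = ∅ := by
          ext v; simp [hcl]
        rw [this, card_empty] at hcard
        omega
    -- the certificate
    refine ⟨cert n k d T, ?_, ?_⟩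
    · -- length budget
      have hTlen : T.length = 3 ^ d * n := by simp [hT]
      rw [length_cert, hTlen, ampLen, ← hd]
      have hd' : d ≤ n := (Nat.log_le_self 3 n).trans le_rfl
      have h1 : (1 : ℕ) ≤ 3 ^ d := Nat.one_le_pow _ _ (by norm_num)
      have h2 : 3 ^ d * n * 4 ≤ 3 ^ d * (n * n) := by
        rw [mul_assoc]; exact Nat.mul_le_mul_left _ (by nlinarith)
      have h3 : n ≤ 3 ^ d * n := Nat.le_mul_of_pos_left _ (by omega)
      nlinarith
    · rw [verdict_eq_true_iff, checks_eq_true_iff]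
      simp only [cn_cert, ck_cert, cd_cert, cT_cert]
      refine ⟨⟨hk, hkn, h3d, h3d', by rw [hu, ampLen]⟩, ?_⟩
      rw [lev0, min_eq_left h3d, rounds_eval]
      change recMaj3 d (fun w => blockBit (List.ofFn x) T n k (finFunctionFinEquiv w)) = true
      simp only [hbits]
      exact hx

/-- The slices at the lengths `ampLen n k` are monotone. -/
theorem monotone_sliceFn_ampCliqueLang (hk : 3 ≤ k) (hkn : k < n) :
    Monotone (ampCliqueLang.sliceFn (ampLen n k)) := by
  intro x x' h
  rw [sliceFn_ampCliqueLang hk hkn, sliceFn_ampCliqueLang hk hkn]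
  exact ampSlice_monotone n k h
/-! ### The input retraction and the transfer -/

/-- The input retraction: position `w' n² + t` ↦ (block `w'`, edge of matrix position `t`); padding
positions wrap around harmlessly. -/
noncomputable def ampRetract (hn : 2 ≤ n) (p : Fin (ampLen n k)) : (Fin (Nat.log 3 n) → Fin 3) × Edge n :=
  (finFunctionFinEquiv.symm ⟨(p : ℕ) / (n * n) % 3 ^ Nat.log 3 n, Nat.mod_lt _ (pow_pos (by norm_num) _)⟩,
    edgeOfPos ⟨s(⟨0, by omega⟩, ⟨1, by omega⟩), by simp [Fin.ext_iff]⟩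
      ⟨(p : ℕ) % (n * n), Nat.mod_lt _ (by nlinarith)⟩)

/-- Pulling back along the retraction, block `w` reads `y (w, ·)` through `edgeOfPos`. -/
theorem blockVec_comp_ampRetract (hn : 2 ≤ n) (y : (Fin (Nat.log 3 n) → Fin 3) × Edge n → Bool)
    (w : Fin (Nat.log 3 n) → Fin 3) :
    blockVec (fun p : Fin (ampLen n k) => y (ampRetract hn p)) w = fun t =>
      y (w, edgeOfPos ⟨s(⟨0, by omega⟩, ⟨1, by omega⟩), by simp [Fin.ext_iff]⟩ t) := by
  funext t
  have hnn : 0 < n * n := by nlinarith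
  have hw := (finFunctionFinEquiv w).2
  simp only [blockVec, ampRetract]
  have hq : ((finFunctionFinEquiv w : ℕ) * (n * n) + t) / (n * n) % 3 ^ Nat.log 3 n =
      (finFunctionFinEquiv w : ℕ) := by
    rw [Nat.add_comm, Nat.add_mul_div_right _ _ hnn, Nat.div_eq_of_lt t.2, zero_add, Nat.mod_eq_of_lt hw]
  have hr : ((finFunctionFinEquiv w : ℕ) * (n * n) + t) % (n * n) = t := by
    rw [Nat.add_comm, Nat.add_mul_mod_self_right, Nat.mod_eq_of_lt t.2]
  congr 1
  · rw [Prod.mk.injEq]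
    refine ⟨?_, ?_⟩
    · have : (⟨((finFunctionFinEquiv w : ℕ) * (n * n) + t) / (n * n) % 3 ^ Nat.log 3 n,
          Nat.mod_lt _ (pow_pos (by norm_num) _)⟩ : Fin (3 ^ Nat.log 3 n)) =
          finFunctionFinEquiv w := Fin.ext hq
      rw [this, Equiv.symm_apply_apply]
    · congr 1
      exact Fin.ext hr

/-- **The slice pulls back to `RM3_d ⊗ CLIQUE(n,k)`** along the retraction. -/
theorem sliceFn_comp_ampRetract (hk : 3 ≤ k) (hkn : k < n)
    (y : (Fin (Nat.log 3 n) → Fin 3) × Edge n → Bool) :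
    ampCliqueLang.sliceFn (ampLen n k) (fun p : Fin (ampLen n k) => y (ampRetract (by omega) p)) =
      ampFn (Nat.log 3 n) (cliqueFn n k) y := by
  rw [sliceFn_ampCliqueLang hk hkn, ampSlice, ampFn]
  congr 1
  funext w
  rw [blockVec_comp_ampRetract, edgeVec_comp_edgeOfPos _ (fun e => y (w, e))]
/-- **Registered stub `stub_slicesNP`** of the skeleton `amplified-window` (stmt-PneNP-19860): the
`RM3 ⊗ CLIQUE` language is in `NP`, its slices at the lengths `ampLen n k` (`3 ≤ k < n`) are monotone and
inherit every negation-limited De Morgan lower bound of `ampFn (Nat.log 3 n) (cliqueFn n k)`. -/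
theorem stub_slicesNP : AmplifiedCliqueSlicesNP := by
  classical
  refine ⟨ampCliqueLang, ampCliqueLang_mem_NP, fun n k hk hkn => ⟨monotone_sliceFn_ampCliqueLang hk hkn, ?_⟩⟩
  intro b s hlow
  refine le_negLimitedSizeOver_of_retract (g := ampFn (Nat.log 3 n) (cliqueFn n k)) (ampRetract (by omega))
    (fun y => sliceFn_comp_ampRetract hk hkn y) ?_ hlow
  obtain ⟨C₀, hB₀, hC₀⟩ := exists_monotone_circuit (ampCliqueLang.sliceFn (ampLen n k))
    (monotone_sliceFn_ampCliqueLang hk hkn)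
    (by rw [sliceFn_ampCliqueLang hk hkn]; exact ampSlice_false hk)
    (by rw [sliceFn_ampCliqueLang hk hkn]; exact ampSlice_true hkn.le)
  exact ⟨C₀, hB₀.mono monotoneBasis_subset_deMorgan,
    (Circuit.negationCount_eq_zero_of_isOver_monotoneBasis hB₀).le.trans (Nat.zero_le _), hC₀⟩

end Summit.PneNP.PneNP.Theorems.NegLimitedAmplifiedWindow
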